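import Summits.Ventures.PercRepro.Defs
import Summits.Ventures.PercRepro.Conditioning
import Summits.Ventures.PercRepro.Induction

/-!
# Gladkov's strong Harris–Kleitman inequality (PLAN.md §1, (K8))

**Theorem** (N. Gladkov, *A strong FKG inequality for multiple events*, Bull. LMS 56 (2024), arXiv:2305.02653,
Theorem 2.1). For a product measure `μ` on `{0,1}^E` and a partition `{0,1}^E = A ⊔ C₁ ⊔ ⋯ ⊔ C_k ⊔ B` with `A`
closed upwards, `B` closed downwards and the `C_i` pairwise incomparable (for `k ≥ 2`: every `A ∪ C_i` closed
upwards), `μ(A) μ(B) ≥ e₂(μ(C₁), …, μ(C_k)) = ∑_{i<j} μ(C_i) μ(C_j)`.  Formalised in **labelled form**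
(`strong_harris_kleitman`): a labelling `τ : Config E → L` by a finite type `L`, labels `a` (the class `A`) and `b`
(the class `B`), the `C_i` = the fibres of the remaining labels `mid a b`; hypothesis `{τ = a} ∪ {τ = c}` upper for
every remaining `c`; conclusion `(∑_c π_c)² - ∑_c π_c² ≤ 2 π_a π_b`, `π_ℓ = P_p(τ = ℓ)`.

**Proof** (the paper's single-coordinate induction, in edge-conditioning form). With
`G(p) = ∑_c π_c² - π_a² - π_b² + 2π_a + 2π_b - 1` the claim is `0 ≤ G(p)`; `induction_free`: `G = 0` for
deterministic weights; for the step `π_ℓ(p) = t π_ℓ¹ + (1 - t) π_ℓ⁰` (`prob_split`) gives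
`G(p) = t G(p¹) + (1 - t) G(p⁰) - t(1 - t) (∑_c Δ_c² - Δ_a² - Δ_b²)`, `Δ = π¹ - π⁰`, and the key inequality
`∑_c Δ_c² ≤ Δ_a² + Δ_b²` (`sum_sq_delta_mid_le`) is proved on two independent copies: `Δ_ℓ = ∑_ω q(ω) d_ℓ(ω)`,
`q ≥ 0`, `d_ℓ(ω) = 1[τ(ω[e:=1]) = ℓ] - 1[τ(ω[e:=0]) = ℓ]`, and pointwise
`∑_c d_c(ω) d_c(ω') ≤ d_a(ω) d_a(ω') + d_b(ω) d_b(ω')` by the four label transitions along an edge (`step_cases`: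
unchanged, `c → a`, `b → a`, `b → c` — the classes `A₀ ⊔ B₀ ⊔ C_i^∘`, `C_i^+`, `D`, `C_i^-` of the paper).
-/

namespace PercRepro

open Finset

variable {E : Type*} [Fintype E] [DecidableEq E]

namespace StrongFKG

variable {L : Type*} [Fintype L] [DecidableEq L]

/-- The labels other than the two distinguished ones. -/
def mid (a b : L) : Finset L := (univ.erase a).erase b

/-- Membership in `mid a b`: the labels other than `a` and `b`. -/
theorem mem_mid {a b c : L} : c ∈ mid a b ↔ c ≠ a ∧ c ≠ b := by simp [mid, and_comm]

/-- `a ∉ mid a b`. -/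
theorem notMem_mid_left (a b : L) : a ∉ mid a b := fun h => (mem_mid.1 h).1 rfl

/-- `b ∉ mid a b`. -/
theorem notMem_mid_right (a b : L) : b ∉ mid a b := fun h => (mem_mid.1 h).2 rfl

/-- The law of the labelling: `law p τ c = P_p(τ = c)`. -/
noncomputable def law (p : E → ℝ) (τ : Config E → L) (c : L) : ℝ := prob p (τ ⁻¹' {c})

omit [Fintype L] [DecidableEq L] in
/-- The law is nonnegative. -/
theorem law_nonneg {p : E → ℝ} (hp : IsProb p) (τ : Config E → L) (c : L) : 0 ≤ law p τ c :=
  prob_nonneg hp _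

/-- The law sums to `1` over the labels. -/
theorem sum_law (p : E → ℝ) (τ : Config E → L) : ∑ c, law p τ c = 1 := sum_prob_fiber p τ

/-- `∑_{c ∈ mid a b} π_c = 1 - π_a - π_b`. -/
theorem sum_law_mid (p : E → ℝ) (τ : Config E → L) {a b : L} (hab : a ≠ b) :
    ∑ c ∈ mid a b, law p τ c = 1 - law p τ a - law p τ b := by
  have h1 := Finset.add_sum_erase univ (law p τ) (mem_univ a)
  have hb : b ∈ univ.erase a := Finset.mem_erase.2 ⟨hab.symm, mem_univ b⟩
  have h2 := Finset.add_sum_erase (univ.erase a) (law p τ) hb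
  rw [sum_law] at h1
  unfold mid
  linarith
/-! ### The four transitions -/

omit [Fintype E] [DecidableEq E] in
/-- **Transition lemma.** Under the sunflower hypothesis with at least two middle labels, when
the configuration increases the label either stays, or moves to `a` (from a middle label or from
`b`), or moves from `b` to a middle label. -/
theorem step_cases (τ : Config E → L) {a b : L}
    (hup : ∀ c ∈ mid a b, IsUpperSet {ω | τ ω = a ∨ τ ω = c})
    (h2 : 2 ≤ (mid a b).card) {ω ω' : Config E} (h : ω ≤ ω') :
    τ ω' = τ ω ∨ (τ ω ∈ mid a b ∧ τ ω' = a) ∨ (τ ω = b ∧ τ ω' = a) ∨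
      (τ ω = b ∧ τ ω' ∈ mid a b) := by
  by_cases ha : τ ω = a
  · -- two distinct middle labels force `τ ω' = a`
    obtain ⟨c₁, hc₁, c₂, hc₂, hne⟩ := Finset.one_lt_card.1 h2
    have e₁ : τ ω' = a ∨ τ ω' = c₁ := hup c₁ hc₁ h (Or.inl ha)
    have e₂ : τ ω' = a ∨ τ ω' = c₂ := hup c₂ hc₂ h (Or.inl ha)
    left
    rw [ha]
    rcases e₁ with e₁ | e₁
    · exact e₁
    rcases e₂ with e₂ | e₂
    · exact e₂
    exact absurd (e₁.symm.trans e₂) hne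
  by_cases hb : τ ω = b
  · by_cases hb' : τ ω' = b
    · left
      rw [hb, hb']
    by_cases ha' : τ ω' = a
    · exact Or.inr (Or.inr (Or.inl ⟨hb, ha'⟩))
    · exact Or.inr (Or.inr (Or.inr ⟨hb, mem_mid.2 ⟨ha', hb'⟩⟩))
  · have hm : τ ω ∈ mid a b := mem_mid.2 ⟨ha, hb⟩
    rcases hup (τ ω) hm h (Or.inr rfl) with h' | h'
    · exact Or.inr (Or.inl ⟨hm, h'⟩)
    · exact Or.inl h'
/-! ### Indicator differences -/

/-- `dv s s' c = 1[s' = c] - 1[s = c]`: the change of the indicator of the label `c` when the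
label moves from `s` to `s'`. -/
def dv (s s' c : L) : ℝ := (if s' = c then 1 else 0) - (if s = c then 1 else 0)

omit [Fintype L] in
/-- `dv s s c = 0`: no change of label, no difference. -/
theorem dv_self (s c : L) : dv s s c = 0 := by
  simp [dv]

omit [Fintype L] in
/-- `∑_{c ∈ S} 1[x = c] 1[y = c] = 1[x = y ∧ x ∈ S]`. -/
theorem sum_ind_mul_ind (S : Finset L) (x y : L) :
    ∑ c ∈ S, (if x = c then (1 : ℝ) else 0) * (if y = c then 1 else 0) =
      if x = y ∧ x ∈ S then 1 else 0 := by
  simp only [ite_mul, one_mul, zero_mul]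
  rw [Finset.sum_ite_eq]
  by_cases hx : x ∈ S
  · by_cases hxy : y = x
    · subst hxy
      simp [hx]
    · have : ¬ (x = y) := fun h => hxy h.symm
      simp [hx, hxy, this]
  · simp [hx]

omit [Fintype L] in
/-- Expansion of `∑_{c ∈ S} dv s s' c * dv u u' c` into four indicator terms. -/
theorem sum_dv_mul_dv (S : Finset L) (s s' u u' : L) :
    ∑ c ∈ S, dv s s' c * dv u u' c =
      (if s' = u' ∧ s' ∈ S then (1 : ℝ) else 0) - (if s' = u ∧ s' ∈ S then 1 else 0) -
        (if s = u' ∧ s ∈ S then 1 else 0) + (if s = u ∧ s ∈ S then 1 else 0) := by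
  have h : ∀ c ∈ S, dv s s' c * dv u u' c =
      (if s' = c then (1 : ℝ) else 0) * (if u' = c then 1 else 0) -
        (if s' = c then (1 : ℝ) else 0) * (if u = c then 1 else 0) -
        (if s = c then (1 : ℝ) else 0) * (if u' = c then 1 else 0) +
        (if s = c then (1 : ℝ) else 0) * (if u = c then 1 else 0) := by
    intro c _
    unfold dv
    ring
  rw [Finset.sum_congr rfl h, Finset.sum_add_distrib, Finset.sum_sub_distrib,
    Finset.sum_sub_distrib, sum_ind_mul_ind, sum_ind_mul_ind, sum_ind_mul_ind, sum_ind_mul_ind]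

/-- The allowed transitions of a label, abstractly. -/
def Ok (a b s s' : L) : Prop :=
  s' = s ∨ (s ∈ mid a b ∧ s' = a) ∨ (s = b ∧ s' = a) ∨ (s = b ∧ s' ∈ mid a b)

/-- **Pointwise key inequality**: for two allowed transitions `s → s'` and `u → u'`,
`∑_{c ∈ mid} dv_c dv'_c ≤ dv_a dv'_a + dv_b dv'_b`. -/
theorem key_pointwise {a b : L} (hab : a ≠ b) {s s' u u' : L} (hs : Ok a b s s')
    (hu : Ok a b u u') :
    ∑ c ∈ mid a b, dv s s' c * dv u u' c ≤ dv s s' a * dv u u' a + dv s s' b * dv u u' b := by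
  rw [sum_dv_mul_dv]
  have hma := notMem_mid_left a b
  have hmb := notMem_mid_right a b
  rcases hs with rfl | ⟨hs1, rfl⟩ | ⟨rfl, rfl⟩ | ⟨rfl, hs2⟩ <;>
    rcases hu with rfl | ⟨hu1, rfl⟩ | ⟨rfl, rfl⟩ | ⟨rfl, hu2⟩ <;>
    simp only [dv, hma, hmb, and_false, if_false, sub_self, zero_mul, mul_zero, add_zero,
      sub_zero, zero_sub] <;>
    (try have := mem_mid.1 hs1) <;> (try have := mem_mid.1 hu1) <;>
    (try have := mem_mid.1 hs2) <;> (try have := mem_mid.1 hu2) <;>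
    (try simp_all) <;> (try split_ifs) <;> (try norm_num) <;> (try (subst_vars; simp_all))
/-! ### One-edge increments as sums over the other edges -/

/-- The weight of the other edges, carried by the configurations in which `e` is closed. -/
def q (p : E → ℝ) (e : E) (ω : Config E) : ℝ := if ω e then 0 else weightErase p e ω

/-- The edge weight `q p e ω` is nonnegative for a probability vector `p`. -/
theorem q_nonneg {p : E → ℝ} (hp : IsProb p) (e : E) (ω : Config E) : 0 ≤ q p e ω := by
  unfold q
  split_ifs
  · exact le_rfl
  · exact weightErase_nonneg hp e ω

omit [Fintype E] [DecidableEq E] [Fintype L] in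
/-- The indicator of the fibre `τ⁻¹ {c}` as an `if`. -/
theorem indicator_fiber (τ : Config E → L) (c : L) (ω : Config E) :
    (τ ⁻¹' {c}).indicator (1 : Config E → ℝ) ω = if τ ω = c then 1 else 0 := by
  by_cases h : τ ω = c <;> simp [Set.indicator, h]

/-- `P_{p[e:=0]}(A) = ∑_ω q(ω) 1_A(ω[e:=0])`. -/
theorem prob_update_zero_eq_sum (p : E → ℝ) (e : E) (A : Set (Config E)) :
    prob (Function.update p e 0) A =
      ∑ ω, q p e ω * A.indicator 1 (Function.update ω e false) := by
  unfold prob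
  refine Finset.sum_congr rfl fun ω _ => ?_
  unfold q
  cases h : ω e
  · have hω : Function.update ω e false = ω := by
      conv_lhs => rw [← h]
      exact Function.update_eq_self e ω
    rw [hω, if_neg (by simp)]
    by_cases hA : ω ∈ A
    · rw [Set.indicator_of_mem hA, Set.indicator_of_mem hA]
      rw [weight_update_zero, if_neg (by simp [h])]
      simp
    · rw [Set.indicator_of_notMem hA, Set.indicator_of_notMem hA]
      simp
  · rw [if_pos rfl, zero_mul]
    by_cases hA : ω ∈ A
    · rw [Set.indicator_of_mem hA, weight_update_zero, if_pos h]
    · rw [Set.indicator_of_notMem hA]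

/-- `P_{p[e:=1]}(A) = ∑_ω q(ω) 1_A(ω[e:=1])` (transport by the edge flip). -/
theorem prob_update_one_eq_sum (p : E → ℝ) (e : E) (A : Set (Config E)) :
    prob (Function.update p e 1) A =
      ∑ ω, q p e ω * A.indicator 1 (Function.update ω e true) := by
  unfold prob
  have hre : ∑ ω, A.indicator (weight (Function.update p e 1)) ω =
      ∑ ω, A.indicator (weight (Function.update p e 1)) (flipEdge e ω) :=
    (Fintype.sum_equiv (flipEdge_involutive e).toPerm _ _ fun ω => by
      simp [Function.Involutive.coe_toPerm]).symm
  rw [hre]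
  refine Finset.sum_congr rfl fun ω _ => ?_
  unfold q
  cases h : ω e
  · have hf : flipEdge e ω = Function.update ω e true := by
      unfold flipEdge
      rw [h]
      rfl
    rw [if_neg (by simp)]
    by_cases hA : Function.update ω e true ∈ A
    · rw [hf, Set.indicator_of_mem hA, Set.indicator_of_mem hA, weight_update_one, ← hf,
        flipEdge_apply_self, h, weightErase_flipEdge]
      simp
    · rw [hf, Set.indicator_of_notMem hA, Set.indicator_of_notMem hA]
      simp
  · rw [if_pos rfl, zero_mul]
    by_cases hA : flipEdge e ω ∈ A
    · rw [Set.indicator_of_mem hA, weight_update_one, flipEdge_apply_self, h]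
      simp
    · rw [Set.indicator_of_notMem hA]

omit [Fintype L] in
/-- The one-edge increment of the law as a `q`-weighted sum of indicator differences. -/
theorem law_update_sub (p : E → ℝ) (e : E) (τ : Config E → L) (c : L) :
    law (Function.update p e 1) τ c - law (Function.update p e 0) τ c =
      ∑ ω, q p e ω * dv (τ (Function.update ω e false)) (τ (Function.update ω e true)) c := by
  unfold law
  rw [prob_update_one_eq_sum, prob_update_zero_eq_sum, ← Finset.sum_sub_distrib]
  refine Finset.sum_congr rfl fun ω _ => ?_
  rw [indicator_fiber, indicator_fiber, dv]
  ring

/-- **Key inequality**: `∑_{c ∈ mid} Δ_c² ≤ Δ_a² + Δ_b²` for the one-edge increments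
`Δ_ℓ = P_{p[e:=1]}(τ = ℓ) - P_{p[e:=0]}(τ = ℓ)`. -/
theorem sum_sq_delta_mid_le (τ : Config E → L) {a b : L} (hab : a ≠ b)
    (hup : ∀ c ∈ mid a b, IsUpperSet {ω | τ ω = a ∨ τ ω = c}) (h2 : 2 ≤ (mid a b).card)
    {p : E → ℝ} (hp : IsProb p) (e : E) :
    ∑ c ∈ mid a b,
        (law (Function.update p e 1) τ c - law (Function.update p e 0) τ c) ^ 2 ≤
      (law (Function.update p e 1) τ a - law (Function.update p e 0) τ a) ^ 2 +
        (law (Function.update p e 1) τ b - law (Function.update p e 0) τ b) ^ 2 := by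
  set D : Config E → L → ℝ :=
    fun ω c => dv (τ (Function.update ω e false)) (τ (Function.update ω e true)) c with hD
  have hOk : ∀ ω : Config E,
      Ok a b (τ (Function.update ω e false)) (τ (Function.update ω e true)) := fun ω =>
    step_cases τ hup h2 ((update_false_le ω e).trans (le_update_true ω e))
  have expand : ∀ c, (law (Function.update p e 1) τ c - law (Function.update p e 0) τ c) ^ 2 =
      ∑ ω, ∑ ω', q p e ω * q p e ω' * (D ω c * D ω' c) := by
    intro c
    rw [law_update_sub, sq, Finset.sum_mul_sum]
    refine Finset.sum_congr rfl fun ω _ => Finset.sum_congr rfl fun ω' _ => ?_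
    simp only [hD]
    ring
  calc ∑ c ∈ mid a b,
          (law (Function.update p e 1) τ c - law (Function.update p e 0) τ c) ^ 2
      = ∑ c ∈ mid a b, ∑ ω, ∑ ω', q p e ω * q p e ω' * (D ω c * D ω' c) :=
        Finset.sum_congr rfl fun c _ => expand c
    _ = ∑ ω, ∑ ω', q p e ω * q p e ω' * ∑ c ∈ mid a b, D ω c * D ω' c := by
        rw [Finset.sum_comm]
        refine Finset.sum_congr rfl fun ω _ => ?_
        rw [Finset.sum_comm]
        refine Finset.sum_congr rfl fun ω' _ => ?_
        rw [Finset.mul_sum]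
    _ ≤ ∑ ω, ∑ ω', q p e ω * q p e ω' * (D ω a * D ω' a + D ω b * D ω' b) :=
        Finset.sum_le_sum fun ω _ => Finset.sum_le_sum fun ω' _ =>
          mul_le_mul_of_nonneg_left (key_pointwise hab (hOk ω) (hOk ω'))
            (mul_nonneg (q_nonneg hp e ω) (q_nonneg hp e ω'))
    _ = (law (Function.update p e 1) τ a - law (Function.update p e 0) τ a) ^ 2 +
          (law (Function.update p e 1) τ b - law (Function.update p e 0) τ b) ^ 2 := by
        rw [expand a, expand b, ← Finset.sum_add_distrib]
        refine Finset.sum_congr rfl fun ω _ => ?_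
        rw [← Finset.sum_add_distrib]
        refine Finset.sum_congr rfl fun ω' _ => ?_
        ring
/-! ### The quadratic functional and the edge induction -/

/-- `Gq p = ∑_{c ∈ mid} π_c² - π_a² - π_b² + 2π_a + 2π_b - 1`; since `∑_{mid} π_c = 1 - π_a - π_b`,
`0 ≤ Gq p` is exactly the strong Harris–Kleitman inequality. -/
noncomputable def Gq (p : E → ℝ) (τ : Config E → L) (a b : L) : ℝ :=
  ∑ c ∈ mid a b, (law p τ c) ^ 2 - (law p τ a) ^ 2 - (law p τ b) ^ 2 +
    2 * law p τ a + 2 * law p τ b - 1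

omit [Fintype L] [DecidableEq L] in
/-- Conditioning on the edge `e`: the law is the `p e`-mixture of the laws with `e` forced open / closed. -/
theorem law_split (p : E → ℝ) (e : E) (τ : Config E → L) (c : L) :
    law p τ c = p e * law (Function.update p e 1) τ c +
      (1 - p e) * law (Function.update p e 0) τ c :=
  prob_split p e _

/-- The chord step: `Gq p ≥ t Gq p¹ + (1 - t) Gq p⁰` because the one-edge increments satisfy
the key inequality. -/
theorem Gq_step (τ : Config E → L) {a b : L} {p : E → ℝ} (hp : IsProb p) (e : E)
    (key : ∑ c ∈ mid a b,
        (law (Function.update p e 1) τ c - law (Function.update p e 0) τ c) ^ 2 ≤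
      (law (Function.update p e 1) τ a - law (Function.update p e 0) τ a) ^ 2 +
        (law (Function.update p e 1) τ b - law (Function.update p e 0) τ b) ^ 2)
    (h1 : 0 ≤ Gq (Function.update p e 1) τ a b) (h0 : 0 ≤ Gq (Function.update p e 0) τ a b) :
    0 ≤ Gq p τ a b := by
  set t := p e with ht
  set x : L → ℝ := law (Function.update p e 1) τ with hx
  set y : L → ℝ := law (Function.update p e 0) τ with hy
  have hs : ∀ c, law p τ c = t * x c + (1 - t) * y c := fun c => law_split p e τ c
  have hsum : ∑ c ∈ mid a b, (law p τ c) ^ 2 =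
      t * ∑ c ∈ mid a b, (x c) ^ 2 + (1 - t) * ∑ c ∈ mid a b, (y c) ^ 2 -
        t * (1 - t) * ∑ c ∈ mid a b, (x c - y c) ^ 2 := by
    rw [Finset.mul_sum, Finset.mul_sum, Finset.mul_sum, ← Finset.sum_add_distrib,
      ← Finset.sum_sub_distrib]
    refine Finset.sum_congr rfl fun c _ => ?_
    rw [hs c]
    ring
  have hid : Gq p τ a b = t * Gq (Function.update p e 1) τ a b +
      (1 - t) * Gq (Function.update p e 0) τ a b -
        t * (1 - t) * (∑ c ∈ mid a b, (x c - y c) ^ 2 - (x a - y a) ^ 2 - (x b - y b) ^ 2) := by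
    unfold Gq
    rw [hsum, hs a, hs b]
    ring
  have ht0 : 0 ≤ t := hp.nonneg e
  have ht1 : 0 ≤ 1 - t := hp.one_sub_nonneg e
  have hk : 0 ≤ (x a - y a) ^ 2 + (x b - y b) ^ 2 - ∑ c ∈ mid a b, (x c - y c) ^ 2 := by
    linarith [key]
  rw [hid]
  nlinarith [mul_nonneg ht0 h1, mul_nonneg ht1 h0, mul_nonneg (mul_nonneg ht0 ht1) hk]

/-- Base case: for deterministic weights every `π_ℓ` is `0` or `1` and `Gq = 0`. -/
theorem Gq_detWeights (σ : Config E) (τ : Config E → L) {a b : L} (hab : a ≠ b) :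
    0 ≤ Gq (detWeights σ) τ a b := by
  have hl : ∀ c, law (detWeights σ) τ c = if τ σ = c then 1 else 0 := fun c => by
    rw [law, prob_detWeights, indicator_fiber]
  unfold Gq
  simp only [hl]
  have hsum : ∑ c ∈ mid a b, (if τ σ = c then (1 : ℝ) else 0) ^ 2 =
      if τ σ ∈ mid a b then 1 else 0 := by
    rw [← Finset.sum_ite_eq (mid a b) (τ σ) (fun _ => (1 : ℝ))]
    refine Finset.sum_congr rfl fun c _ => ?_
    split_ifs <;> norm_num
  rw [hsum]
  by_cases ha : τ σ = a
  · rw [ha]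
    simp [notMem_mid_left, hab]
    norm_num
  · by_cases hb : τ σ = b
    · rw [hb]
      simp [notMem_mid_right, hab.symm]
      norm_num
    · have hm : τ σ ∈ mid a b := mem_mid.2 ⟨ha, hb⟩
      simp [hm, ha, hb]

/-- `0 ≤ Gq p` for every probability vector `p` (edge induction). -/
theorem Gq_nonneg (τ : Config E → L) {a b : L} (hab : a ≠ b)
    (hup : ∀ c ∈ mid a b, IsUpperSet {ω | τ ω = a ∨ τ ω = c}) (h2 : 2 ≤ (mid a b).card)
    {p : E → ℝ} (hp : IsProb p) : 0 ≤ Gq p τ a b :=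
  induction_free (P := fun p => 0 ≤ Gq p τ a b) (fun σ => Gq_detWeights σ τ hab)
    (fun _ e hp' h1 h0 => Gq_step τ hp' e (sum_sq_delta_mid_le τ hab hup h2 hp' e) h1 h0) hp

end StrongFKG

open StrongFKG in
/-- **Gladkov's strong Harris–Kleitman inequality** (Bull. LMS 56 (2024), arXiv:2305.02653,
Thm 2.1), labelled form. `τ` labels the configurations by a finite type `L`; `a` is the label of
the upper class `A`, `b` that of the lower class `B`, and the remaining labels `c ∈ mid a b` are
the classes `C_i`. If `{τ = a} ∪ {τ = c}` is an upper set for every remaining `c`, then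
`(∑_c π_c)² - ∑_c π_c² ≤ 2 π_a π_b`, i.e. `e₂(π_c) ≤ π_a π_b`, where `π_ℓ = P_p(τ = ℓ)`. -/
theorem strong_harris_kleitman {L : Type*} [Fintype L] [DecidableEq L] (τ : Config E → L)
    {a b : L} (hab : a ≠ b) (hup : ∀ c ∈ mid a b, IsUpperSet {ω | τ ω = a ∨ τ ω = c})
    {p : E → ℝ} (hp : IsProb p) :
    (∑ c ∈ mid a b, prob p (τ ⁻¹' {c})) ^ 2 - ∑ c ∈ mid a b, (prob p (τ ⁻¹' {c})) ^ 2 ≤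
      2 * (prob p (τ ⁻¹' {a}) * prob p (τ ⁻¹' {b})) := by
  change (∑ c ∈ mid a b, law p τ c) ^ 2 - ∑ c ∈ mid a b, (law p τ c) ^ 2 ≤
    2 * (law p τ a * law p τ b)
  by_cases h2 : 2 ≤ (mid a b).card
  · have hG := Gq_nonneg τ hab hup h2 hp
    unfold Gq at hG
    rw [sum_law_mid p τ hab]
    nlinarith [hG]
  · have hc : (mid a b).card ≤ 1 := by omega
    have h0 : (∑ c ∈ mid a b, law p τ c) ^ 2 - ∑ c ∈ mid a b, (law p τ c) ^ 2 = 0 := by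
      rcases (mid a b).eq_empty_or_nonempty with h | ⟨x, hx⟩
      · simp [h]
      · have hx' : mid a b = {x} :=
          Finset.eq_singleton_iff_unique_mem.2 ⟨hx, fun y hy => Finset.card_le_one.1 hc y hy x hx⟩
        simp [hx']
    rw [h0]
    exact mul_nonneg zero_le_two (mul_nonneg (law_nonneg hp τ a) (law_nonneg hp τ b))

end PercRepro
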